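import Summits.QuantumFields.YangMills.Theorems.UnitScaleTiltProp7CovPinnedKernelL1OfRows
import HarnessLib

/-!
# Route `UnitScaleTilt`, crux K1 «MinimiserStabilityRegPr» (stmt-QuantumFields-19200), route-R E′ path (α′), (E1-b) at the CURVED background — near-field transplant, gen-1 «(ID)»:
# THE EXACT TWO-GENERATION IDENTITY — `Δ_U²(V⁰ − V¹) = (Δ²ψ)•R(Fr)Y + Δ_U(E₁ − K₁) − K₂ + R(Fr)m`: the first generation's SITE junk `E₂` is cancelled by the flat biharmonic potential of
# `J̃₂ = R(Fr)⁻¹E₂` transplanted back (LOCATE-PCOV2 v1.3 §6); pure linearity bookkeeping, every «junk» being a DIFFERENCE of tree terms (no `def`)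

Cell `ym3-torus`, extra width seat `ym-routeR-w6` (gen 6).  THEOREMS ONLY (0 `def`, 0 `sorry`); `--supports stmt-QuantumFields-19200`, count-neutral.  YM₃ on T³ is a ladder rung (R3),
not the Clay problem; nothing here claims a stub, the crux, d = 4 or the mass gap.

WHAT IS PROVED (ns `…Theorems.Prop7TransplantTwoGen`; torus `Site P i`, any unit field `U`, any `Fr`; `Δ_Uf x := divB T U (fun μ => covD T U μ f) x`).
* `covLaplace_congr` (pointwise-equal fields have equal `Δ_U`), `covLaplace_R_smul_const` bookkeeping.
* ★★★ `covBilaplace_two_generation` (and the cutoff-split forms ★★★ `covBilaplace_two_generation'`, px22 g3 23:20Z: `Δψ = g′ + c₁`, and ★★★ `covBilaplace_two_generation''`, (G1-b) 23:36Z: also `Δ_flat F = F′ + c₁′`) — with the auxiliary fields bound by their DEFINING EQUATIONS as hypotheses (`hE₁ : ∀ z, E₁ z = Δ_UV⁰ z − (Δψ z)•R(Fr z)Y`, `hE₂`, `hK₁`, `hK₂`), the flat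
  biharmonic identity `hF : ∀ z, Δ_flat(Δ_flat F) z = J z − m z` and the matching `hJ : ∀ z, R(Fr z)(J z) = E₂ z`:
  `∀ x, Δ_U(Δ_U(V⁰ − V¹)) x = (Δ²ψ x)•R(Fr x)Y + Δ_U(E₁ − K₁) x − K₂ x + R(Fr x)(m x)`, `V⁰ = ψ•R(Fr)Y`, `V¹ = R(Fr)F`.
READING (px22's covariant door ✓p673628∕p674320): intended source = the dipole inside `(Δ²ψ)•R(Fr)Y`; TYPE-1 `h := E₁ − K₁`; SITE `s := −K₂ + R(Fr)m` (+ cutoff shells); `ht := 0`;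
the numbers from ✓p675919 (`E₁`, scalar×constant) and ✓∕⧗`…TransplantNormsField` (`K₁ K₂`, matrix field).

References: T. Bałaban, CMP 99 (1985) 389–434 [Balaban1985BackgroundPropagators] ((3.8) p.392, (3.28) p.395); CMP 96 (1984) 223–250 [Balaban1984PropagatorsII] ((1.9) p.226).
-/

set_option autoImplicit false

noncomputable section

open scoped BigOperators Matrix

namespace Summit.QuantumFields.YangMills.Theorems.Prop7TransplantTwoGen

open Literature.MathematicalPhysics.QuantumFieldTheory.Balaban1983to89
open B9Eq39Adjoint (R R_def covD covDstar divB)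
open B9TorusCalculus (torusT torusT_apply torusT_symm_apply)
open Summit.QuantumFields.YangMills.Theorems.Prop7CovInterpKernelDual (covLaplace_sub)
open Summit.QuantumFields.YangMills.Theorems.Prop7CovPinnedKernelL1OfRows (covLaplace_add)

variable {P : Params} {i : ℕ} {N : ℕ} (U : Fin P.d → Site P i → (Matrix (Fin N) (Fin N) ℂ)ˣ)

/-- pointwise-equal fields have the same covariant Laplacian. [folklore] -/
theorem covLaplace_congr {f g : Site P i → Matrix (Fin N) (Fin N) ℂ} (h : ∀ z, f z = g z) (x : Site P i) :
    divB (torusT P i) U (fun μ => covD (torusT P i) U μ f) x = divB (torusT P i) U (fun μ => covD (torusT P i) U μ g) x := by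
  rw [show f = g from funext h]

/-- ★★★ **THE EXACT TWO-GENERATION IDENTITY** (see the module docstring). [cite: Balaban1985BackgroundPropagators, (3.8) p.392, (3.28) p.395] -/
theorem covBilaplace_two_generation (Fr : Site P i → (Matrix (Fin N) (Fin N) ℂ)ˣ) (ψ : Site P i → ℝ) (Y : Matrix (Fin N) (Fin N) ℂ)
    (F J m E₁ E₂ K₁ K₂ : Site P i → Matrix (Fin N) (Fin N) ℂ)
    (hE₁ : ∀ z, E₁ z = divB (torusT P i) U (fun μ => covD (torusT P i) U μ (fun y => ψ y • R (Fr y) Y)) z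
      - (∑ μ : Fin P.d, (2 * ψ z - ψ (torusT P i μ z) - ψ ((torusT P i μ).symm z))) • R (Fr z) Y)
    (hE₂ : ∀ z, E₂ z = divB (torusT P i) U (fun μ => covD (torusT P i) U μ
        (fun y => (∑ μ : Fin P.d, (2 * ψ y - ψ (torusT P i μ y) - ψ ((torusT P i μ).symm y))) • R (Fr y) Y)) z
      - (∑ ν : Fin P.d, (2 * (∑ μ : Fin P.d, (2 * ψ z - ψ (torusT P i μ z) - ψ ((torusT P i μ).symm z)))
          - (∑ μ : Fin P.d, (2 * ψ (torusT P i ν z) - ψ (torusT P i μ (torusT P i ν z)) - ψ ((torusT P i μ).symm (torusT P i ν z))))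
          - (∑ μ : Fin P.d, (2 * ψ ((torusT P i ν).symm z) - ψ (torusT P i μ ((torusT P i ν).symm z)) - ψ ((torusT P i μ).symm ((torusT P i ν).symm z)))))) • R (Fr z) Y)
    (hK₁ : ∀ z, K₁ z = divB (torusT P i) U (fun μ => covD (torusT P i) U μ (fun y => R (Fr y) (F y))) z
      - R (Fr z) (∑ μ : Fin P.d, ((F z - F (torusT P i μ z)) + (F z - F ((torusT P i μ).symm z)))))
    (hK₂ : ∀ z, K₂ z = divB (torusT P i) U (fun μ => covD (torusT P i) U μ
        (fun y => R (Fr y) (∑ μ : Fin P.d, ((F y - F (torusT P i μ y)) + (F y - F ((torusT P i μ).symm y)))))) z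
      - R (Fr z) (∑ ν : Fin P.d, (((∑ μ : Fin P.d, ((F z - F (torusT P i μ z)) + (F z - F ((torusT P i μ).symm z))))
          - (∑ μ : Fin P.d, ((F (torusT P i ν z) - F (torusT P i μ (torusT P i ν z))) + (F (torusT P i ν z) - F ((torusT P i μ).symm (torusT P i ν z))))))
          + ((∑ μ : Fin P.d, ((F z - F (torusT P i μ z)) + (F z - F ((torusT P i μ).symm z))))
          - (∑ μ : Fin P.d, ((F ((torusT P i ν).symm z) - F (torusT P i μ ((torusT P i ν).symm z)))
              + (F ((torusT P i ν).symm z) - F ((torusT P i μ).symm ((torusT P i ν).symm z)))))))))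
    (hF : ∀ z, (∑ ν : Fin P.d, (((∑ μ : Fin P.d, ((F z - F (torusT P i μ z)) + (F z - F ((torusT P i μ).symm z))))
          - (∑ μ : Fin P.d, ((F (torusT P i ν z) - F (torusT P i μ (torusT P i ν z))) + (F (torusT P i ν z) - F ((torusT P i μ).symm (torusT P i ν z))))))
          + ((∑ μ : Fin P.d, ((F z - F (torusT P i μ z)) + (F z - F ((torusT P i μ).symm z))))
          - (∑ μ : Fin P.d, ((F ((torusT P i ν).symm z) - F (torusT P i μ ((torusT P i ν).symm z)))
              + (F ((torusT P i ν).symm z) - F ((torusT P i μ).symm ((torusT P i ν).symm z)))))))) = J z - m z)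
    (hJ : ∀ z, R (Fr z) (J z) = E₂ z) (x : Site P i) :
    divB (torusT P i) U (fun μ => covD (torusT P i) U μ
        (fun y => divB (torusT P i) U (fun ν => covD (torusT P i) U ν (fun z => ψ z • R (Fr z) Y - R (Fr z) (F z))) y)) x
      = (∑ ν : Fin P.d, (2 * (∑ μ : Fin P.d, (2 * ψ x - ψ (torusT P i μ x) - ψ ((torusT P i μ).symm x)))
          - (∑ μ : Fin P.d, (2 * ψ (torusT P i ν x) - ψ (torusT P i μ (torusT P i ν x)) - ψ ((torusT P i μ).symm (torusT P i ν x))))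
          - (∑ μ : Fin P.d, (2 * ψ ((torusT P i ν).symm x) - ψ (torusT P i μ ((torusT P i ν).symm x)) - ψ ((torusT P i μ).symm ((torusT P i ν).symm x)))))) • R (Fr x) Y
        + divB (torusT P i) U (fun μ => covD (torusT P i) U μ (fun z => E₁ z - K₁ z)) x - K₂ x + R (Fr x) (m x) := by
  -- Step 1: `Δ_U(V⁰ − V¹) = ((Δψ)•RY + E₁) − (R(Fr)Δ_flat F + K₁)` pointwise
  have h1 : ∀ y, divB (torusT P i) U (fun ν => covD (torusT P i) U ν (fun z => ψ z • R (Fr z) Y - R (Fr z) (F z))) y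
      = ((∑ μ : Fin P.d, (2 * ψ y - ψ (torusT P i μ y) - ψ ((torusT P i μ).symm y))) • R (Fr y) Y + E₁ y)
        - (R (Fr y) (∑ μ : Fin P.d, ((F y - F (torusT P i μ y)) + (F y - F ((torusT P i μ).symm y)))) + K₁ y) := by
    intro y
    rw [covLaplace_sub, hE₁ y, hK₁ y]; abel
  rw [covLaplace_congr U h1, covLaplace_sub, covLaplace_add, covLaplace_add]
  -- Step 2: the second generation: `Δ_U(R(Fr)Δ_flat F) = R(Fr)(J − m) + K₂ = E₂ − R(Fr)m + K₂`
  have h2 : divB (torusT P i) U (fun μ => covD (torusT P i) U μ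
      (fun y => R (Fr y) (∑ μ : Fin P.d, ((F y - F (torusT P i μ y)) + (F y - F ((torusT P i μ).symm y)))))) x
      = E₂ x - R (Fr x) (m x) + K₂ x := by
    rw [hK₂ x, hF x, B9Eq39Adjoint.R_sub, hJ x]; abel
  -- Step 3: the first generation: `Δ_U((Δψ)•RY) = (Δ²ψ)•RY + E₂`
  have h3 := hE₂ x
  rw [h2, covLaplace_sub]
  rw [eq_sub_iff_add_eq] at h3
  rw [← h3]
  abel

/-- ★★★ **THE TWO-GENERATION IDENTITY WITH THE CUTOFF SPLIT ONE LAPLACIAN EARLY** (px22 g3's reshape 23:20Z): with a FREE scalar `g′` and shell term `c₁` such that `Δψ = g′ + c₁`, and the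
second comparison taken on `g′` (`hE₂`), `Δ_U²(V⁰ − V¹) = (Δg′)•R(Fr)Y + Δ_U(E₁ + c₁•R(Fr)Y − K₁) − K₂ + R(Fr)m` — at `c₁ = 0`, `g′ = Δψ` it is `covBilaplace_two_generation`.
READING: `g′ := χ·ΔV_flat`, `c₁ := [Δ, χ]V_flat` (TYPE-1, undifferentiated), `Δg′ = dipole + [Δ, χ]ΔV_flat` (SITE). [cite: Balaban1985BackgroundPropagators, (3.8) p.392, (3.28) p.395] -/
theorem covBilaplace_two_generation' (Fr : Site P i → (Matrix (Fin N) (Fin N) ℂ)ˣ) (ψ g' c₁ : Site P i → ℝ) (Y : Matrix (Fin N) (Fin N) ℂ)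
    (F J m E₁ E₂ K₁ K₂ : Site P i → Matrix (Fin N) (Fin N) ℂ)
    (hψ : ∀ z, (∑ μ : Fin P.d, (2 * ψ z - ψ (torusT P i μ z) - ψ ((torusT P i μ).symm z))) = g' z + c₁ z)
    (hE₁ : ∀ z, E₁ z = divB (torusT P i) U (fun μ => covD (torusT P i) U μ (fun y => ψ y • R (Fr y) Y)) z
      - (∑ μ : Fin P.d, (2 * ψ z - ψ (torusT P i μ z) - ψ ((torusT P i μ).symm z))) • R (Fr z) Y)
    (hE₂ : ∀ z, E₂ z = divB (torusT P i) U (fun μ => covD (torusT P i) U μ (fun y => g' y • R (Fr y) Y)) z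
      - (∑ ν : Fin P.d, (2 * g' z - g' (torusT P i ν z) - g' ((torusT P i ν).symm z))) • R (Fr z) Y)
    (hK₁ : ∀ z, K₁ z = divB (torusT P i) U (fun μ => covD (torusT P i) U μ (fun y => R (Fr y) (F y))) z
      - R (Fr z) (∑ μ : Fin P.d, ((F z - F (torusT P i μ z)) + (F z - F ((torusT P i μ).symm z)))))
    (hK₂ : ∀ z, K₂ z = divB (torusT P i) U (fun μ => covD (torusT P i) U μ
        (fun y => R (Fr y) (∑ μ : Fin P.d, ((F y - F (torusT P i μ y)) + (F y - F ((torusT P i μ).symm y)))))) z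
      - R (Fr z) (∑ ν : Fin P.d, (((∑ μ : Fin P.d, ((F z - F (torusT P i μ z)) + (F z - F ((torusT P i μ).symm z))))
          - (∑ μ : Fin P.d, ((F (torusT P i ν z) - F (torusT P i μ (torusT P i ν z))) + (F (torusT P i ν z) - F ((torusT P i μ).symm (torusT P i ν z))))))
          + ((∑ μ : Fin P.d, ((F z - F (torusT P i μ z)) + (F z - F ((torusT P i μ).symm z))))
          - (∑ μ : Fin P.d, ((F ((torusT P i ν).symm z) - F (torusT P i μ ((torusT P i ν).symm z)))
              + (F ((torusT P i ν).symm z) - F ((torusT P i μ).symm ((torusT P i ν).symm z)))))))))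
    (hF : ∀ z, (∑ ν : Fin P.d, (((∑ μ : Fin P.d, ((F z - F (torusT P i μ z)) + (F z - F ((torusT P i μ).symm z))))
          - (∑ μ : Fin P.d, ((F (torusT P i ν z) - F (torusT P i μ (torusT P i ν z))) + (F (torusT P i ν z) - F ((torusT P i μ).symm (torusT P i ν z))))))
          + ((∑ μ : Fin P.d, ((F z - F (torusT P i μ z)) + (F z - F ((torusT P i μ).symm z))))
          - (∑ μ : Fin P.d, ((F ((torusT P i ν).symm z) - F (torusT P i μ ((torusT P i ν).symm z)))
              + (F ((torusT P i ν).symm z) - F ((torusT P i μ).symm ((torusT P i ν).symm z)))))))) = J z - m z)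
    (hJ : ∀ z, R (Fr z) (J z) = E₂ z) (x : Site P i) :
    divB (torusT P i) U (fun μ => covD (torusT P i) U μ
        (fun y => divB (torusT P i) U (fun ν => covD (torusT P i) U ν (fun z => ψ z • R (Fr z) Y - R (Fr z) (F z))) y)) x
      = (∑ ν : Fin P.d, (2 * g' x - g' (torusT P i ν x) - g' ((torusT P i ν).symm x))) • R (Fr x) Y
        + divB (torusT P i) U (fun μ => covD (torusT P i) U μ (fun z => E₁ z + c₁ z • R (Fr z) Y - K₁ z)) x - K₂ x + R (Fr x) (m x) := by
  -- Step 1: `Δ_U(V⁰ − V¹) = (g′•RY + (E₁ + c₁•RY)) − (R(Fr)Δ_flat F + K₁)` pointwise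
  have h1 : ∀ y, divB (torusT P i) U (fun ν => covD (torusT P i) U ν (fun z => ψ z • R (Fr z) Y - R (Fr z) (F z))) y
      = (g' y • R (Fr y) Y + (E₁ y + c₁ y • R (Fr y) Y))
        - (R (Fr y) (∑ μ : Fin P.d, ((F y - F (torusT P i μ y)) + (F y - F ((torusT P i μ).symm y)))) + K₁ y) := by
    intro y
    rw [covLaplace_sub, hE₁ y, hK₁ y, hψ y, add_smul]; abel
  have hA : divB (torusT P i) U (fun μ => covD (torusT P i) U μ (fun y => g' y • R (Fr y) Y + (E₁ y + c₁ y • R (Fr y) Y))) x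
      = divB (torusT P i) U (fun μ => covD (torusT P i) U μ (fun y => g' y • R (Fr y) Y)) x
        + divB (torusT P i) U (fun μ => covD (torusT P i) U μ (fun z => E₁ z + c₁ z • R (Fr z) Y)) x := covLaplace_add _ _ x
  have hB : divB (torusT P i) U (fun μ => covD (torusT P i) U μ (fun y =>
        R (Fr y) (∑ μ : Fin P.d, ((F y - F (torusT P i μ y)) + (F y - F ((torusT P i μ).symm y)))) + K₁ y)) x
      = divB (torusT P i) U (fun μ => covD (torusT P i) U μ (fun y =>
          R (Fr y) (∑ μ : Fin P.d, ((F y - F (torusT P i μ y)) + (F y - F ((torusT P i μ).symm y)))))) x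
        + divB (torusT P i) U (fun μ => covD (torusT P i) U μ K₁) x := covLaplace_add _ _ x
  rw [covLaplace_congr U h1, covLaplace_sub, hA, hB]
  have h2 : divB (torusT P i) U (fun μ => covD (torusT P i) U μ
      (fun y => R (Fr y) (∑ μ : Fin P.d, ((F y - F (torusT P i μ y)) + (F y - F ((torusT P i μ).symm y)))))) x
      = E₂ x - R (Fr x) (m x) + K₂ x := by
    rw [hK₂ x, hF x, B9Eq39Adjoint.R_sub, hJ x]; abel
  have h3 := hE₂ x
  have h4 : divB (torusT P i) U (fun μ => covD (torusT P i) U μ (fun z => E₁ z + c₁ z • R (Fr z) Y - K₁ z)) x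
      = divB (torusT P i) U (fun μ => covD (torusT P i) U μ (fun z => E₁ z + c₁ z • R (Fr z) Y)) x
        - divB (torusT P i) U (fun μ => covD (torusT P i) U μ K₁) x := covLaplace_sub _ _ x
  rw [h2, h4]
  rw [eq_sub_iff_add_eq] at h3
  rw [← h3]
  abel

/-- ★★★ **BOTH HALVES SPLIT** (px22 g3 (G1-b) 23:36Z): as `covBilaplace_two_generation'`, and additionally the second generation's flat Laplacian split as `Δ_flat F = F′ + c₁′`
(`F′` free, `c₁′` the cutoff shell), the second comparison taken on `F′` (`hK₂`) and the flat identity on `F′` (`hF′ : Δ_flat F′ = J − m`):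
`Δ_U²(V⁰ − V¹) = (Δg′)•R(Fr)Y + Δ_U(E₁ + c₁•R(Fr)Y − K₁ − R(Fr)c₁′) − K₂ + R(Fr)m`. [cite: Balaban1985BackgroundPropagators, (3.8) p.392, (3.28) p.395] -/
theorem covBilaplace_two_generation'' (Fr : Site P i → (Matrix (Fin N) (Fin N) ℂ)ˣ) (ψ g' c₁ : Site P i → ℝ) (Y : Matrix (Fin N) (Fin N) ℂ)
    (F F' c₁' J m E₁ E₂ K₁ K₂ : Site P i → Matrix (Fin N) (Fin N) ℂ)
    (hψ : ∀ z, (∑ μ : Fin P.d, (2 * ψ z - ψ (torusT P i μ z) - ψ ((torusT P i μ).symm z))) = g' z + c₁ z)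
    (hE₁ : ∀ z, E₁ z = divB (torusT P i) U (fun μ => covD (torusT P i) U μ (fun y => ψ y • R (Fr y) Y)) z
      - (∑ μ : Fin P.d, (2 * ψ z - ψ (torusT P i μ z) - ψ ((torusT P i μ).symm z))) • R (Fr z) Y)
    (hE₂ : ∀ z, E₂ z = divB (torusT P i) U (fun μ => covD (torusT P i) U μ (fun y => g' y • R (Fr y) Y)) z
      - (∑ ν : Fin P.d, (2 * g' z - g' (torusT P i ν z) - g' ((torusT P i ν).symm z))) • R (Fr z) Y)
    (hK₁ : ∀ z, K₁ z = divB (torusT P i) U (fun μ => covD (torusT P i) U μ (fun y => R (Fr y) (F y))) z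
      - R (Fr z) (∑ μ : Fin P.d, ((F z - F (torusT P i μ z)) + (F z - F ((torusT P i μ).symm z)))))
    (hFsplit : ∀ z, (∑ μ : Fin P.d, ((F z - F (torusT P i μ z)) + (F z - F ((torusT P i μ).symm z)))) = F' z + c₁' z)
    (hK₂ : ∀ z, K₂ z = divB (torusT P i) U (fun μ => covD (torusT P i) U μ (fun y => R (Fr y) (F' y))) z
      - R (Fr z) (∑ ν : Fin P.d, ((F' z - F' (torusT P i ν z)) + (F' z - F' ((torusT P i ν).symm z)))))
    (hF' : ∀ z, (∑ ν : Fin P.d, ((F' z - F' (torusT P i ν z)) + (F' z - F' ((torusT P i ν).symm z)))) = J z - m z)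
    (hJ : ∀ z, R (Fr z) (J z) = E₂ z) (x : Site P i) :
    divB (torusT P i) U (fun μ => covD (torusT P i) U μ
        (fun y => divB (torusT P i) U (fun ν => covD (torusT P i) U ν (fun z => ψ z • R (Fr z) Y - R (Fr z) (F z))) y)) x
      = (∑ ν : Fin P.d, (2 * g' x - g' (torusT P i ν x) - g' ((torusT P i ν).symm x))) • R (Fr x) Y
        + divB (torusT P i) U (fun μ => covD (torusT P i) U μ (fun z => E₁ z + c₁ z • R (Fr z) Y - K₁ z - R (Fr z) (c₁' z))) x - K₂ x + R (Fr x) (m x) := by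
  -- Step 1: `Δ_U(V⁰ − V¹) = (g′•RY + (E₁ + c₁•RY)) − (R(Fr)F′ + (K₁ + R(Fr)c₁′))` pointwise
  have h1 : ∀ y, divB (torusT P i) U (fun ν => covD (torusT P i) U ν (fun z => ψ z • R (Fr z) Y - R (Fr z) (F z))) y
      = (g' y • R (Fr y) Y + (E₁ y + c₁ y • R (Fr y) Y))
        - (R (Fr y) (F' y) + (K₁ y + R (Fr y) (c₁' y))) := by
    intro y
    rw [covLaplace_sub, hE₁ y, hK₁ y, hψ y, add_smul, hFsplit y, B9Eq39Adjoint.R_add]; abel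
  have hA : divB (torusT P i) U (fun μ => covD (torusT P i) U μ (fun y => g' y • R (Fr y) Y + (E₁ y + c₁ y • R (Fr y) Y))) x
      = divB (torusT P i) U (fun μ => covD (torusT P i) U μ (fun y => g' y • R (Fr y) Y)) x
        + divB (torusT P i) U (fun μ => covD (torusT P i) U μ (fun z => E₁ z + c₁ z • R (Fr z) Y)) x := covLaplace_add _ _ x
  have hB : divB (torusT P i) U (fun μ => covD (torusT P i) U μ (fun y => R (Fr y) (F' y) + (K₁ y + R (Fr y) (c₁' y)))) x
      = divB (torusT P i) U (fun μ => covD (torusT P i) U μ (fun y => R (Fr y) (F' y))) x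
        + divB (torusT P i) U (fun μ => covD (torusT P i) U μ (fun y => K₁ y + R (Fr y) (c₁' y))) x := covLaplace_add _ _ x
  rw [covLaplace_congr U h1, covLaplace_sub, hA, hB]
  have h2 : divB (torusT P i) U (fun μ => covD (torusT P i) U μ (fun y => R (Fr y) (F' y))) x = E₂ x - R (Fr x) (m x) + K₂ x := by
    rw [hK₂ x, hF' x, B9Eq39Adjoint.R_sub, hJ x]; abel
  have h3 := hE₂ x
  have h4 : divB (torusT P i) U (fun μ => covD (torusT P i) U μ (fun z => E₁ z + c₁ z • R (Fr z) Y - K₁ z - R (Fr z) (c₁' z))) x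
      = divB (torusT P i) U (fun μ => covD (torusT P i) U μ (fun z => E₁ z + c₁ z • R (Fr z) Y)) x
        - divB (torusT P i) U (fun μ => covD (torusT P i) U μ (fun z => K₁ z + R (Fr z) (c₁' z))) x := by
    have e : (fun z => E₁ z + c₁ z • R (Fr z) Y - K₁ z - R (Fr z) (c₁' z)) = fun z => (E₁ z + c₁ z • R (Fr z) Y) - (K₁ z + R (Fr z) (c₁' z)) :=
      funext fun z => by abel
    rw [e]; exact covLaplace_sub _ _ x
  rw [h2, h4]
  rw [eq_sub_iff_add_eq] at h3
  rw [← h3]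
  abel

end Summit.QuantumFields.YangMills.Theorems.Prop7TransplantTwoGen

end
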